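import Summits.Ventures.PercRepro.Night2ThreeTwoObstructionThirteen

/-!
# PercRepro — the cell `(3, 2)`: the weakly bad targets above a covering basis (night-2, gen 26)

Groundwork for the obstruction cells with `|V| ≤ 10`, continued: the shape of a weakly bad target `S` above a covering
basis `K ∪ T`.  Its rank-`≤ 2` part `R = (S ∖ K) ∖ {x, w, w′}` contains one or two of the four basis points (three would
have rank `3`), and with two of them, `u, v`, it lies in their line `cl {u, v}`.  So the weakly bad targets above `K ∪ T`
are the sets `R ∪ {x, w, w′}` with `R` on a line through one basis point (`R` then carries exactly one basis point and
`{x, w, w′}` the three others) or on the line through two basis points `u, v` (`{x, w, w′} ⊇ T ∖ {u, v}`) — binomial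
counts in the sizes of the lines through the basis points.

* **`wbad_target_structure`**: `1 ≤ |T ∩ R| ≤ 2`, and `R ⊆ cl (T ∩ R)` when `|T ∩ R| = 2`.
-/

namespace PercRepro.Shadow

open Finset PerFlat ThmH

variable {α : Type*} [DecidableEq α] {M : Matroid α} [M.Finite]

section WeakBadStructure

variable {G : Finset α}

open scoped Classical in
/-- **THE STRUCTURE OF A WEAKLY BAD TARGET ABOVE A COVERING BASIS**: with `R = (S ∖ K) ∖ {x, w, w′}` of rank `≤ 2`,
the basis `T = Q ∖ K` meets `R` in one or two points, and in two points `u, v` only if `R ⊆ cl {u, v}`. -/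
theorem wbad_target_structure (hG : G ∈ flatsQ M (5 + 1)) (hk : kColoops M G = 2)
    (hs : ∀ e ∈ gr M, ∀ f ∈ gr M, e ≠ f → rkN M {e, f} = 2)
    {Q : Finset α} (hQ : Q ∈ shadowAt M (5 + 2) 5 (Uq M (5 + 2) 5) G) (hQc : (Q \ coloops M G).card = 4)
    {S : Finset α} (hS : S ∈ shadowAt M (5 + 2) 5 (Uq M (5 + 2) 5) G) (hQS : Q ⊆ S)
    {x w w' : α} (hr : rkN M ((S \ coloops M G) \ {x, w, w'}) ≤ 2) :
    1 ≤ ((Q \ coloops M G) ∩ ((S \ coloops M G) \ {x, w, w'})).card ∧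
      ((Q \ coloops M G) ∩ ((S \ coloops M G) \ {x, w, w'})).card ≤ 2 ∧
      (((Q \ coloops M G) ∩ ((S \ coloops M G) \ {x, w, w'})).card = 2 →
        (S \ coloops M G) \ {x, w, w'} ⊆ clF M ((Q \ coloops M G) ∩ ((S \ coloops M G) \ {x, w, w'}))) := by
  have hk' : kColoops M G + 4 = 5 + 1 := by omega
  have hGg : G ⊆ gr M := (mem_flatsQ.1 hG).1
  have hSG : S ⊆ G := subset_G_of_mem_shadowAt hS
  set R := (S \ coloops M G) \ {x, w, w'} with hR
  set T := Q \ coloops M G with hT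
  have hRg : R ⊆ gr M := Finset.sdiff_subset.trans (Finset.sdiff_subset.trans (hSG.trans hGg))
  have hTI : M.Indep (T : Set α) :=
    (indep_of_mem_shadowAt_card hk' hQ hQc).subset (by exact_mod_cast (Finset.sdiff_subset : T ⊆ Q))
  -- `T ∩ R` is independent of rank `≤ 2`: at most two points
  have hTR : M.Indep ((T ∩ R : Finset α) : Set α) :=
    hTI.subset (by exact_mod_cast (Finset.inter_subset_left : T ∩ R ⊆ T))
  have hcard2 : (T ∩ R).card ≤ 2 := by
    have h1 : rkN M (T ∩ R) = (T ∩ R).card := by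
      have h := hTR.eRk_eq_encard
      rw [eRk_eq_rkN, Set.encard_coe_eq_coe_finsetCard] at h
      exact_mod_cast h
    have h2 : rkN M (T ∩ R) ≤ rkN M R := rkN_mono Finset.inter_subset_right
    omega
  -- `T ∖ R ⊆ {x, w, w′}`, so `|T ∩ R| ≥ 4 − 3`
  have hcard1 : 1 ≤ (T ∩ R).card := by
    have hsub : T \ R ⊆ {x, w, w'} := by
      intro a ha
      rw [Finset.mem_sdiff] at ha
      by_contra hxa
      apply ha.2
      rw [hR, Finset.mem_sdiff]
      exact ⟨Finset.sdiff_subset_sdiff hQS (Finset.Subset.refl _) ha.1, hxa⟩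
    have h3 : ({x, w, w'} : Finset α).card ≤ 3 := Finset.card_le_three
    have := Finset.card_le_card hsub
    have := Finset.card_sdiff_add_card_inter T R
    omega
  refine ⟨hcard1, hcard2, fun h2 => ?_⟩
  have hinter : R ∩ (T ∩ R) = T ∩ R := Finset.inter_eq_right.2 Finset.inter_subset_right
  have := subset_clF_inter_of_rkN_le_two hs hRg hr (X' := T ∩ R) (by rw [hinter, h2])
  rwa [hinter] at this

end WeakBadStructure

end PercRepro.Shadow
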